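/-
Copyright (c) 2026. All rights reserved.
Released under Apache 2.0 license as described in the file LICENSE.
Authors: abc-iut cell, prover seat abc-iut-w4-d095 (wave 4, gen 5), following abc-iut-L4-t3's `LogFrobeniusGenuineIotaOver`
pattern verbatim (see the imports).
-/
import Literature.AnabelianGeometry.AbsoluteAnabelian.LogFrobeniusNonarchGenuineOver
import Literature.AnabelianGeometry.AbsoluteAnabelian.LogFrobeniusIotaOver
import HarnessLib

/-!
# [AbsTopIII] Definition 5.4 (vii): the `ι⊞_{v,ε}` lie over `Th•[Z]` AT THE SETTING OVER A SUB-MODEL `ι : C ⥤ 𝒳` and at the SLIM carrier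

S. Mochizuki, *Topics in absolute anabelian geometry III: global reconstruction algorithms*, J. Math. Sci. Univ.
Tokyo 22 (2015) 939–1156 [MochizukiAbsTopIII2015]; locators = pages of the author's manuscript
(`paper:url-5493eb38cbb7`): Def 5.4 (iv) p. 127 (the `λ⊞_{v,ν}`, `λ_{v,ν}` "lie over" `Th•[Z]`), (vii) p. 128 (the
`ι⊞_{v,ε}`, `ι_{v,ε}`).

PROOF-ONLY (no `def`; nothing restated).  abc-iut-L4-t3's interface add-on `LogFrobeniusSetting.IotaOver` /
`TSHomotopies.IotaOverTS` (`LogFrobeniusIotaOver.lean`) HOLDS at this seat's setting over ANY sub-model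
`nonarchGenuineOver p ι` (`LogFrobeniusNonarchGenuineOver.lean`) and in particular at the SLIM genuine-nonarchimedean MLF
carrier `nonarchGenuineSlim p` — by abc-iut-L4-t3's method for `nonarchGenuine p` (`LogFrobeniusGenuineIotaOver.lean`),
verbatim: `ι⊞_{v,ε} = (𝟙, ι_ε ∘ ι)` has first component the identity of the base object, and every structure isomorphism
of the setting is an identity.  These are the genuine-carrier inputs abc-iut-f-102's THEOREM B (F-0159 / F-0157) reads
at the slim carrier, where total `□`-rigidity (F-0155) also holds (`nonarchGenuineSlim_cor55CoreRigid`).  Refereed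
pre-IUT material; OUR kernel checks over model settings; nothing here bears on [IUTchIII] Cor. 3.12; no side taken;
instance at a model ≠ the printed theorem; typed ≠ proved.
-/

set_option autoImplicit false

noncomputable section

open CategoryTheory

namespace Literature.AnabelianGeometry.AbsoluteAnabelian

namespace LogFrobeniusSetting

open AbsTopIII

variable (p : ℕ) [Fact p.Prime] {C : Type 1} [Category.{1} C] (ι : C ⥤ TFModel p) (Vmod : Type 1)
  (isArc : Vmod → Bool)

/-- Per-Boolean form of `nonarchGenuineOver_iotaOver`: at each object both sides are composites of identities of the
underlying object of `C`. [cite: MochizukiAbsTopIII2015, Def 5.4 (vii) p. 128] -/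
private theorem nonarchGenuineOver_iotaOver_aux (b : Bool) {ν₁ ν₂ : LogVertex b} (ε : LogEdge b ν₁ ν₂) :
    Functor.whiskerRight (overIota p ι b ε)
        (𝟭 (Up (C × TSObj)) ⋙ Up.liftF (CategoryTheory.Prod.fst C TSObj)) =
      (Functor.associator _ _ _ ≪≫ Functor.isoWhiskerLeft _ (overLamOver p ι b ν₁) ≪≫
          (nonarchGenuineOver p ι Vmod isArc).twistOver ν₁.isPostLog).hom ≫
        (overLamOver p ι b ν₂).inv := by
  ext X₀
  cases b
  · cases ν₁ <;>
    · change (𝟙 X₀.down ≫ 𝟙 X₀.down : X₀.down ⟶ X₀.down) =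
          (𝟙 X₀.down ≫ (𝟙 X₀.down ≫ 𝟙 X₀.down)) ≫ 𝟙 X₀.down
      simp
  · cases ν₁ <;>
    · change (𝟙 X₀.down ≫ 𝟙 X₀.down : X₀.down ⟶ X₀.down) =
          (𝟙 X₀.down ≫ (𝟙 X₀.down ≫ 𝟙 X₀.down)) ≫ 𝟙 X₀.down
      simp

/-- **`IotaOver` HOLDS at the setting over any sub-model `ι : C ⥤ 𝒳`**: the `ι⊞_{v,ε} = (𝟙, ι_ε ∘ ι)` lie over
`Th•[Z] = Up C` (first components identities). [cite: MochizukiAbsTopIII2015, Def 5.4 (vii) p. 128] -/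
theorem nonarchGenuineOver_iotaOver : (nonarchGenuineOver p ι Vmod isArc).IotaOver :=
  fun v _ _ ε => nonarchGenuineOver_iotaOver_aux p ι Vmod isArc (isArc v) ε

/-- Per-Boolean form of `nonarchGenuineOverTS_iotaOverTS` (all six `TS`-valued arrows; one associator more).
[cite: MochizukiAbsTopIII2015, Def 5.4 (vii) p. 128] -/
private theorem nonarchGenuineOverTS_iotaOverTS_aux (b : Bool) {ν₁ ν₂ : LogVertex b} (ε : LogEdgeTS b ν₁ ν₂) :
    Functor.whiskerRight (overIotaTS p ι b ε) (Up.liftF (CategoryTheory.Prod.fst C TSObj)) =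
      (Functor.associator _ _ _).hom ≫
        (Functor.associator _ _ _ ≪≫ Functor.isoWhiskerLeft _ (overLamOver p ι b ν₁) ≪≫
            (nonarchGenuineOver p ι Vmod isArc).twistOver ν₁.isPostLog).hom ≫
          (overLamOver p ι b ν₂).inv ≫ (Functor.associator _ _ _).inv := by
  ext X₀
  cases b
  · cases ν₁ <;>
    · change (𝟙 X₀.down ≫ 𝟙 X₀.down : X₀.down ⟶ X₀.down) =
          𝟙 X₀.down ≫ ((𝟙 X₀.down ≫ (𝟙 X₀.down ≫ 𝟙 X₀.down)) ≫ (𝟙 X₀.down ≫ 𝟙 X₀.down))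
      simp
  · cases ν₁ <;>
    · change (𝟙 X₀.down ≫ 𝟙 X₀.down : X₀.down ⟶ X₀.down) =
          𝟙 X₀.down ≫ ((𝟙 X₀.down ≫ (𝟙 X₀.down ≫ 𝟙 X₀.down)) ≫ (𝟙 X₀.down ≫ 𝟙 X₀.down))
      simp

/-- **`IotaOverTS` HOLDS for the `TS` datum `nonarchGenuineOverTS p ι`** over any sub-model.
[cite: MochizukiAbsTopIII2015, Def 5.4 (vii) p. 128] -/
theorem nonarchGenuineOverTS_iotaOverTS : (nonarchGenuineOverTS p ι Vmod isArc).IotaOverTS :=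
  fun v _ _ ε => nonarchGenuineOverTS_iotaOverTS_aux p ι Vmod isArc (isArc v) ε

/-- **At the SLIM genuine-nonarchimedean MLF carrier**: `IotaOver` holds (and F-0155 holds there,
`nonarchGenuineSlim_cor55CoreRigid`) — the carrier at which abc-iut-f-102's THEOREM B inputs and total `□`-rigidity meet.
[cite: MochizukiAbsTopIII2015, Def 5.4 (vii) p. 128] -/
theorem nonarchGenuineSlim_iotaOver_and_coreRigid :
    (nonarchGenuineSlim p Vmod isArc).IotaOver ∧ (nonarchGenuineSlim p Vmod isArc).Cor55CoreRigid :=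
  ⟨nonarchGenuineOver_iotaOver p _ Vmod isArc, nonarchGenuineSlim_cor55CoreRigid p Vmod isArc⟩

/-- The `TS` half at the slim carrier. [cite: MochizukiAbsTopIII2015, Def 5.4 (vii) p. 128] -/
theorem nonarchGenuineSlimTS_iotaOverTS :
    (nonarchGenuineOverTS p (ObjectProperty.ι _ : TFModel.Slim p ⥤ TFModel p) Vmod isArc).IotaOverTS :=
  nonarchGenuineOverTS_iotaOverTS p _ Vmod isArc

end LogFrobeniusSetting

end Literature.AnabelianGeometry.AbsoluteAnabelian

end
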